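import Summits.QuantumFields.YangMills.Theorems.BalabanLadderIRAbstractBasinRung6
import Mathlib.Analysis.Normed.Ring.InfiniteSum
import HarnessLib

/-!
# The 2D PAIRING EMBEDDING into the abstract-basin class (helper for item 19354, line `basin-transfer`)

AUTHORSHIP: written and kernel-checked by the critic seat ym-ir-crit-3 g0 (`pub/ym-ir/ym-ir-crit-3/PROBE-abstractBasin-pairing.lean`,
PRELOAD-abstractBasin64.md §3, 2026-08-28T03:53Z; "landable by any seat with propose rights; rename the namespace"); landed verbatim modulo
namespace / imports by ideator ym-ir-idea-9 under RULING director-ym g9-№2 / №14(3), with one added corollary `no_low_plateau6` of the third landed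
rung `basin_step6` (p603750).
HONEST FRAMING: group- and locality-free bookkeeping; nothing here touches Yang–Mills content; the YM mass gap (Clay) is NOT
proved by any of this; the crux `BalabanLadder.IR` (stmt-QuantumFields-19354) is NOT proved; R4 closes only `BalabanLadder.UV`.

For a 2D family `z : ℕ → ℕ → ℝ` that is axis-symmetric (`z x y = z y x`), trace-positive with unit atoms
(`HasSpectralDatum (z x)` for `x ≥ 4`) and exponentially volume-bounded, the PAIRING family
  `pairing α z a b c d = e^{−α·abcd} · z(ab,cd) · z(ac,bd) · z(ad,bc)`
is `IsAxisSymmetric ∧ IsTracePositive ∧ HasVolumeBounds` (α = 3κ), and its box defect is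
  `boxDefect (pairing α z) L = 1 − z(L², L·2⌊L/4⌋)³ / (z(L², L·⌊L/4⌋)³)²`.
Consequences: `abstractBasin_pairing` (every `AbstractBasin θ ε` is a falsifiable 2D statement) and `no_low_plateau`
(the LANDED `basin_step9` forbids 2D inputs whose induced 4D defect is a constant `D ∈ (0, 2⁻⁹]` along `L = 4n`).
-/

set_option autoImplicit false

noncomputable section

open scoped BigOperators
open Summit.QuantumFields.YangMills.Cruxes.IR.AspectBootstrap
open Summit.QuantumFields.YangMills.Cruxes.IR.BasinRung

namespace Summit.QuantumFields.YangMills.Cruxes.IR.BasinRung.Pairing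

/-! ## §1 Closure properties of `HasSpectralDatum` -/

/-- product of two spectral data is a spectral datum (atoms multiply, index types multiply). -/
theorem hasSpectralDatum_mul {z w : ℕ → ℝ} (hz : HasSpectralDatum z) (hw : HasSpectralDatum w) :
    HasSpectralDatum (fun n => z n * w n) := by
  obtain ⟨ι, lam, i₀, hle, hpos, hsum⟩ := hz
  obtain ⟨κ, mu, j₀, hle', hpos', hsum'⟩ := hw
  refine ⟨ι × κ, fun p => lam p.1 * mu p.2, (i₀, j₀), fun p => ⟨mul_nonneg (hle p.1).1 (hle' p.2).1,
    mul_le_mul (hle p.1).2 (hle' p.2).2 (hle' p.2).1 (hle i₀).1⟩, mul_pos hpos hpos', fun m => ?_⟩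
  have hf0 : 0 ≤ fun i => lam i ^ (m + 2) := fun i => pow_nonneg (hle i).1 _
  have hg0 : 0 ≤ fun j => mu j ^ (m + 2) := fun j => pow_nonneg (hle' j).1 _
  have hS := (hsum m).summable.mul_of_nonneg (hsum' m).summable hf0 hg0
  have h := (hsum m).mul (hsum' m) hS
  simpa [mul_pow] using h

/-- dilation: `n ↦ z (k n)` has a spectral datum (atoms `λᵢ^k`) for `k ≥ 1`. -/
theorem hasSpectralDatum_dilate {z : ℕ → ℝ} (hz : HasSpectralDatum z) {k : ℕ} (hk : 1 ≤ k) :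
    HasSpectralDatum (fun n => z (k * n)) := by
  obtain ⟨ι, lam, i₀, hle, hpos, hsum⟩ := hz
  refine ⟨ι, fun i => lam i ^ k, i₀, fun i => ⟨pow_nonneg (hle i).1 _, pow_le_pow_left₀ (hle i).1 (hle i).2 _⟩,
    pow_pos hpos _, fun m => ?_⟩
  have h2 : m + 2 ≤ k * (m + 2) := by nlinarith
  obtain ⟨m', hm'⟩ : ∃ m', k * (m + 2) = m' + 2 := ⟨k * (m + 2) - 2, by omega⟩
  have h := hsum m'
  rw [← hm'] at h
  simpa [← pow_mul] using h

/-- scaling by `c^n`, `c > 0` (atoms `c·λᵢ`). -/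
theorem hasSpectralDatum_pow_mul {z : ℕ → ℝ} (hz : HasSpectralDatum z) {c : ℝ} (hc : 0 < c) :
    HasSpectralDatum (fun n => c ^ n * z n) := by
  obtain ⟨ι, lam, i₀, hle, hpos, hsum⟩ := hz
  refine ⟨ι, fun i => c * lam i, i₀, fun i => ⟨mul_nonneg hc.le (hle i).1, mul_le_mul_of_nonneg_left (hle i).2 hc.le⟩,
    mul_pos hc hpos, fun m => ?_⟩
  have h := (hsum m).mul_left (c ^ (m + 2))
  simpa [mul_pow] using h

/-! ## §2 The pairing family -/

/-- `pairing α z (a,b,c,d) = e^{−α·abcd} · z(ab,cd) · z(ac,bd) · z(ad,bc)`. -/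
def pairing (α : ℝ) (z : ℕ → ℕ → ℝ) (a b c d : ℕ) : ℝ :=
  Real.exp (-(α * ((a * b * c * d : ℕ) : ℝ))) * (z (a * b) (c * d) * z (a * c) (b * d) * z (a * d) (b * c))

variable {z : ℕ → ℕ → ℝ}

/-- [Sym]: the three transpositions permute the pair-partitions (orientation handled by `z x y = z y x`). -/
theorem pairing_axisSymmetric (α : ℝ) (hsym : ∀ x y, z x y = z y x) : IsAxisSymmetric (pairing α z) := by
  intro a b c d
  refine ⟨?_, ?_, ?_⟩
  · unfold pairing
    rw [show z (d * b) (c * a) = z (a * c) (b * d) by rw [Nat.mul_comm d b, Nat.mul_comm c a, hsym],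
      show z (d * c) (b * a) = z (a * b) (c * d) by rw [Nat.mul_comm d c, Nat.mul_comm b a, hsym],
      show z (d * a) (b * c) = z (a * d) (b * c) by rw [Nat.mul_comm d a]]
    push_cast; ring_nf
  · unfold pairing
    rw [show z (b * a) (c * d) = z (a * b) (c * d) by rw [Nat.mul_comm b a],
      show z (b * c) (a * d) = z (a * d) (b * c) by rw [hsym],
      show z (b * d) (a * c) = z (a * c) (b * d) by rw [hsym]]
    push_cast; ring_nf
  · unfold pairing
    rw [show z (c * b) (a * d) = z (a * d) (b * c) by rw [Nat.mul_comm c b, hsym],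
      show z (c * a) (b * d) = z (a * c) (b * d) by rw [Nat.mul_comm c a],
      show z (c * d) (b * a) = z (a * b) (c * d) by rw [Nat.mul_comm b a, hsym]]
    push_cast; ring_nf

/-- [TM]: in direction `d` every factor carries `d` linearly, so the product is unit-atomic. -/
theorem pairing_tracePositive (α : ℝ) (hsym : ∀ x y, z x y = z y x)
    (htp : ∀ x : ℕ, 4 ≤ x → HasSpectralDatum (z x)) : IsTracePositive (pairing α z) := by
  intro b₁ b₂ b₃ h1 h2 h3
  have e : pairing α z b₁ b₂ b₃ = fun τ => (Real.exp (-(α * ((b₁ * b₂ * b₃ : ℕ) : ℝ)))) ^ τ *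
      ((z (b₁ * b₂) (b₃ * τ) * z (b₁ * b₃) (b₂ * τ)) * z (b₂ * b₃) (b₁ * τ)) := by
    funext τ
    unfold pairing
    rw [hsym (b₁ * τ) (b₂ * b₃), ← Real.exp_nat_mul]
    congr 1
    · congr 1; push_cast; ring
  rw [e]
  have hA : HasSpectralDatum (fun τ => z (b₁ * b₂) (b₃ * τ)) := hasSpectralDatum_dilate (htp _ (by nlinarith)) (by omega)
  have hB : HasSpectralDatum (fun τ => z (b₁ * b₃) (b₂ * τ)) := hasSpectralDatum_dilate (htp _ (by nlinarith)) (by omega)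
  have hC : HasSpectralDatum (fun τ => z (b₂ * b₃) (b₁ * τ)) := hasSpectralDatum_dilate (htp _ (by nlinarith)) (by omega)
  have hABC : HasSpectralDatum (fun τ => (z (b₁ * b₂) (b₃ * τ) * z (b₁ * b₃) (b₂ * τ)) * z (b₂ * b₃) (b₁ * τ)) :=
    hasSpectralDatum_mul (hasSpectralDatum_mul hA hB) hC
  exact hasSpectralDatum_pow_mul hABC (Real.exp_pos _)

/-- [Vol]: exponential 2D volume bounds `e^{−κxy} ≤ z(x,y) ≤ e^{κxy}` give `e^{−6κ·abcd} ≤ pairing (3κ) z ≤ 1`. -/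
theorem pairing_volumeBounds {κ : ℝ}
    (hvol : ∀ x y : ℕ, 4 ≤ x → 4 ≤ y → Real.exp (-(κ * x * y)) ≤ z x y ∧ z x y ≤ Real.exp (κ * x * y)) :
    HasVolumeBounds (pairing (3 * κ) z) := by
  refine ⟨6 * κ, fun a b c d ha hb hc hd => ?_⟩
  obtain ⟨l1, u1⟩ := hvol (a * b) (c * d) (by nlinarith) (by nlinarith)
  obtain ⟨l2, u2⟩ := hvol (a * c) (b * d) (by nlinarith) (by nlinarith)
  obtain ⟨l3, u3⟩ := hvol (a * d) (b * c) (by nlinarith) (by nlinarith)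
  have p1 : 0 ≤ z (a * b) (c * d) := (Real.exp_pos _).le.trans l1
  have p2 : 0 ≤ z (a * c) (b * d) := (Real.exp_pos _).le.trans l2
  have p3 : 0 ≤ z (a * d) (b * c) := (Real.exp_pos _).le.trans l3
  have hE : 0 ≤ Real.exp (-(3 * κ * ((a * b * c * d : ℕ) : ℝ))) := (Real.exp_pos _).le
  unfold pairing
  constructor
  · calc Real.exp (-(6 * κ * ((a * b * c * d : ℕ) : ℝ)))
        = Real.exp (-(3 * κ * ((a * b * c * d : ℕ) : ℝ))) * (Real.exp (-(κ * ((a * b : ℕ) : ℝ) * ((c * d : ℕ) : ℝ))) *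
            Real.exp (-(κ * ((a * c : ℕ) : ℝ) * ((b * d : ℕ) : ℝ))) * Real.exp (-(κ * ((a * d : ℕ) : ℝ) * ((b * c : ℕ) : ℝ)))) := by
          rw [← Real.exp_add, ← Real.exp_add, ← Real.exp_add]; congr 1; push_cast; ring
      _ ≤ _ := by gcongr
  · calc Real.exp (-(3 * κ * ((a * b * c * d : ℕ) : ℝ))) * (z (a * b) (c * d) * z (a * c) (b * d) * z (a * d) (b * c))
        ≤ Real.exp (-(3 * κ * ((a * b * c * d : ℕ) : ℝ))) * (Real.exp (κ * ((a * b : ℕ) : ℝ) * ((c * d : ℕ) : ℝ)) *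
            Real.exp (κ * ((a * c : ℕ) : ℝ) * ((b * d : ℕ) : ℝ)) * Real.exp (κ * ((a * d : ℕ) : ℝ) * ((b * c : ℕ) : ℝ))) := by
          gcongr
      _ = 1 := by
          rw [← Real.exp_add, ← Real.exp_add, ← Real.exp_add, ← Real.exp_zero]; congr 1; push_cast; ring

/-- The box defect of the pairing family is a pure 2D quantity (the volume gauge cancels). -/
theorem pairing_boxDefect (α : ℝ) (hsym : ∀ x y, z x y = z y x) (L : ℕ) :
    boxDefect (pairing α z) L = 1 - z (L * L) (L * (2 * (L / 4))) ^ 3 / (z (L * L) (L * (L / 4)) ^ 3) ^ 2 := by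
  unfold boxDefect pairing
  rw [hsym (L * (2 * (L / 4))) (L * L), hsym (L * (L / 4)) (L * L)]
  have hE : Real.exp (-(α * ((L * L * L * (2 * (L / 4)) : ℕ) : ℝ))) =
      Real.exp (-(α * ((L * L * L * (L / 4) : ℕ) : ℝ))) ^ 2 := by
    rw [← Real.exp_nat_mul]; congr 1; push_cast; ring
  have hpos : 0 < Real.exp (-(α * ((L * L * L * (L / 4) : ℕ) : ℝ))) := Real.exp_pos _
  rw [hE, mul_pow, mul_div_mul_left _ _ (pow_ne_zero 2 hpos.ne')]
  ring

/-! ## §3 Consequences -/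

/-- **Every `AbstractBasin θ ε` is a falsifiable 2D statement.** -/
theorem abstractBasin_pairing {θ ε : ℝ} (hA : AbstractBasin θ ε) {κ : ℝ}
    (hsym : ∀ x y, z x y = z y x) (htp : ∀ x : ℕ, 4 ≤ x → HasSpectralDatum (z x))
    (hvol : ∀ x y : ℕ, 4 ≤ x → 4 ≤ y → Real.exp (-(κ * x * y)) ≤ z x y ∧ z x y ≤ Real.exp (κ * x * y))
    (L : ℕ) (hL : 8 ≤ L) (hδ : 1 - z (L * L) (L * (2 * (L / 4))) ^ 3 / (z (L * L) (L * (L / 4)) ^ 3) ^ 2 ≤ θ) :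
    ∃ L' : ℕ, 8 ≤ L' ∧ 1 - z (L' * L') (L' * (2 * (L' / 4))) ^ 3 / (z (L' * L') (L' * (L' / 4)) ^ 3) ^ 2 ≤ ε := by
  obtain ⟨L', hL', h'⟩ := hA (pairing (3 * κ) z) (pairing_axisSymmetric _ hsym) (pairing_tracePositive _ hsym htp)
    (pairing_volumeBounds hvol) L hL (by rwa [pairing_boxDefect _ hsym])
  exact ⟨L', hL', by rwa [pairing_boxDefect _ hsym] at h'⟩

/-- **Corollary of the LANDED rung** (`basin_step9`): no admissible 2D input induces a constant 4D defect
`D ∈ (0, 2⁻⁹]` along `L = 4n` — e.g. no S-symmetric ℕ-coefficient exponential sum with unique vacuum has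
`0 < 1 − e^{−3πc_eff}(…) ≤ 2⁻⁹`. -/
theorem no_low_plateau {κ : ℝ} (hsym : ∀ x y, z x y = z y x) (htp : ∀ x : ℕ, 4 ≤ x → HasSpectralDatum (z x))
    (hvol : ∀ x y : ℕ, 4 ≤ x → 4 ≤ y → Real.exp (-(κ * x * y)) ≤ z x y ∧ z x y ≤ Real.exp (κ * x * y))
    {D : ℝ} (hD0 : 0 < D) (hD : D ≤ 1 / 2 ^ 9)
    (hplat : ∀ n : ℕ, 2 ≤ n → boxDefect (pairing (3 * κ) z) (4 * n) = D) : False := by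
  have h := basin_step9 (pairing_axisSymmetric _ hsym) (pairing_tracePositive _ hsym htp) (pairing_volumeBounds hvol)
    (4 * 2) (by norm_num) (le_of_eq (hplat 2 le_rfl)) hD
  rw [show 2 * (4 * 2) = 4 * 4 by norm_num, hplat 4 (by norm_num)] at h
  nlinarith [mul_le_mul_of_nonneg_left hD (by positivity : (0 : ℝ) ≤ 395 * D)]

/-- Same with the second LANDED rung `basin_step8` (p603051, no [Vol] needed): no constant 4D defect `D ∈ (0, 2⁻⁸]`
along `L = 4n` — the plateau set of 2D-embedded families misses `(0, 2⁻⁸]` entirely. -/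
theorem no_low_plateau8 (α : ℝ) (hsym : ∀ x y, z x y = z y x) (htp : ∀ x : ℕ, 4 ≤ x → HasSpectralDatum (z x))
    {D : ℝ} (hD0 : 0 < D) (hD : D ≤ 1 / 2 ^ 8)
    (hplat : ∀ n : ℕ, 2 ≤ n → boxDefect (pairing α z) (4 * n) = D) : False := by
  have h := basin_step8 (pairing_axisSymmetric α hsym) (pairing_tracePositive α hsym htp)
    (4 * 2) (by norm_num) (le_of_eq (hplat 2 le_rfl)) hD
  rw [show 2 * (4 * 2) = 4 * 4 by norm_num, hplat 4 (by norm_num)] at h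
  nlinarith [mul_le_mul_of_nonneg_left hD (by positivity : (0 : ℝ) ≤ 201 * D)]

/-- Same with the third LANDED rung `basin_step6` (p603750, time-first squaring, no [Vol]): no constant 4D defect `D ∈ (0, 2⁻⁶]`
along `L = 4n` — the plateau set of 2D-embedded families misses `(0, 2⁻⁶]` entirely (indeed `(0, 1/37)`). -/
theorem no_low_plateau6 (α : ℝ) (hsym : ∀ x y, z x y = z y x) (htp : ∀ x : ℕ, 4 ≤ x → HasSpectralDatum (z x))
    {D : ℝ} (hD0 : 0 < D) (hD : D ≤ 1 / 2 ^ 6)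
    (hplat : ∀ n : ℕ, 2 ≤ n → boxDefect (pairing α z) (4 * n) = D) : False := by
  have h := basin_step6 (pairing_axisSymmetric α hsym) (pairing_tracePositive α hsym htp)
    (4 * 2) (by norm_num) (le_of_eq (hplat 2 le_rfl)) hD
  rw [show 2 * (4 * 2) = 4 * 4 by norm_num, hplat 4 (by norm_num)] at h
  nlinarith [mul_le_mul_of_nonneg_left hD (by positivity : (0 : ℝ) ≤ 37 * D)]

/-- Packaging: along `L = 4n` a 2D-embedded family has NO constant box defect in `(0, 2⁻⁶]` (plateau heights of the pairing class
lie in `{0} ∪ (2⁻⁶, 1]`). -/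
theorem pairing_plateau_dichotomy (α : ℝ) (hsym : ∀ x y, z x y = z y x) (htp : ∀ x : ℕ, 4 ≤ x → HasSpectralDatum (z x))
    {D : ℝ} (hD0 : 0 ≤ D) (hplat : ∀ n : ℕ, 2 ≤ n → boxDefect (pairing α z) (4 * n) = D) :
    D = 0 ∨ 1 / 2 ^ 6 < D := by
  rcases hD0.eq_or_lt with h | h
  · exact Or.inl h.symm
  · refine Or.inr (lt_of_not_ge fun hc => ?_)
    exact no_low_plateau6 α hsym htp h hc hplat


end Summit.QuantumFields.YangMills.Cruxes.IR.BasinRung.Pairing
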